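import Summits.HodgeConjecture.HodgeConjecture.Theorems.MarkmanPartnerTransportFiniteMorphismTranscendental
import Summits.HodgeConjecture.HodgeConjecture.Theorems.MarkmanPartnerTransportPicardThreeK3SquaresIsogenyDatumTraceSign
import Summits.HodgeConjecture.HodgeConjecture.Theorems.MarkmanPartnerTransportPicardThreeK3SquaresSqrtSix
import Literature.AlgebraicGeometry.HodgeTheory.IntegralGeneratorTrace

/-!
# Route MarkmanPartnerTransport · crux `PicardThreeK3Squares` (stmt-HodgeConjecture-19652) —
# programme «ISOGENY DATUM», brick 3: a ROOF `Y ←π— Z —f→ X` of morphisms of cohomological degrees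
# `d`, `n` (a dominant rational map of degree `n / d`) between marked projective K3 surfaces is a
# VARESCO DATUM of multiplier `n · d`; hence every Hodge similitude `√(n d)` of `T(X)` is cycle-induced
# and HC⁴(X ⊗ X) follows under the sector clause `End_Hdg T(X) ⊆ ℚ + ℚ ψ`

Planner task T-P1AT-21 (cell hodge-nonav, memo ROUTE-P1AT §15.2 «a dominant rational map of degree `d`
between projective K3 surfaces is a datum of multiplier `d`»), typed over the tree's real carriers. A
dominant rational map `Y ⇢ X` of projective K3 surfaces is presented by a ROOF: a smooth projective
surface `Z` of geometric genus one (e.g. a blow-up of `Y`; `HasGeometricGenusOne`) with morphisms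
`π : Z ⟶ Y`, `f : Z ⟶ X` of cohomological degrees `d ≠ 0`, `n ≠ 0` (`g₊ 1 = deg • 1`; `d = 1` for a
birational `π`). With the graph class `γ = (f, π)₊ 1 ∈ H⁴((X ⊗ Y)(ℂ); ℂ)` (algebraic) the
correspondence `φ = [γ]_* = f₊ π^*` (brick 1 `corr_gysinLift_one`) is rational, Hodge-type preserving,
maps `T(Y)` ONTO `T(X)` and scales the intersection forms by `n · d` there — using `T(Z) = f^* T(X) =
π^* T(Y)` (brick 2, Schur). In the MARKINGS this reads `(η φa · η φb) = n d (η_Y a · η_Y b)` AS SOON AS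
the two integral generators `p ∈ H⁴(X)`, `p_Y ∈ H⁴(Y)` of the markings have the same trace
(`htr : ∫_X p = ∫_Y p_Y`), and `htr` HOLDS: the trace of an integral generator is `± ε₀⁻¹`
(`Literature.….IntegralGeneratorTrace.traceC_eq_or_eq_neg_traceC_of_integral_generators`: Poincaré
duality over `ℤ` and `[X(ℂ)] = [X(ℂ)]_ℤ ⊗ 1`) and the sign is fixed through the roof
(`IsogenyDatum.traceC_eq_traceC_of_roof`, brick 4: the `(2,0)`-classes of `X`, `Y` become proportional
on `Z`):

* `datum_transcendental`, `datum_onto`, `datum_rational`, `datum_hodgeType` — the datum clauses of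
  `φ = f₊ π^*` that need no normalisation;
* `traceC_cup_datum` — **`∫_X (φ a ∪ φ b) = n d · ∫_Y (a ∪ b)`** on `T(Y)` (trace form, exact);
* `k3Form_datum_of_traceC_eq` — the marking form `(η φa · η φb) = n d (η_Y a · η_Y b)` granted `htr`;
* `cycleInduced_of_roof` — **every `ψ` with `ψ² = n d` and multiplier `n d` on `T(X)` (rational,
  type-preserving there) is CYCLE-INDUCED**, modulo `Buskin2019_hodgeIsometry_algebraic` and `htr`
  (`QuotientSimilitude.cycleInduced_of_algebraicSimilitude` fed with the roof datum);
* `hodgeConjectureFor_square_of_roof` — **HC⁴(X ⊗ X)** if moreover `End_Hdg T(X) ⊆ ℚ + ℚψ`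
  (`SqrtSix.hodgeConjectureFor_square_of_corr_similitude`);
* `traceC_eq_traceC_of_markedRoof` — **`∫_X p = ∫_Y p_Y`** for any two marked projective K3 surfaces
  joined by a roof; `cycleInduced_of_roof'`, `hodgeConjectureFor_square_of_roof'` — the UNCONDITIONAL
  forms (modulo `Buskin2019_hodgeIsometry_algebraic` ONLY); rational SELF-maps are the case `Y = X`.

Honest scope: a finite MORPHISM of degree `≥ 2` between K3 surfaces does not exist (K3 surfaces are
simply connected), so `Z` is never `Y` itself when `n ≥ 2`: the roof is the content. THEOREMS ONLY (no
definition, no named fact, no sorry). Prover seat hodge-nonav-19652-p1 (gen 21),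
`--supports stmt-HodgeConjecture-19652`. Nothing here proves the crux: this is a SECTOR theorem
(K3 surfaces receiving a rational map of degree `n d` from a K3 surface, with real multiplication by
`ℚ(√(n d))` exactly).

References: M. Varesco, Math. Z. 305 (2023) §2 Thm. 2.1; H. Inose, Proc. Int. Symp. Algebraic Geometry
Kyoto 1977 (1978) §2; W. Fulton, *Intersection Theory* §16.1; N. Buskin, J. reine angew. Math. 755
(2019) Thm. 1.1; B. van Geemen, M. Schütt, arXiv:2310.05196 Prop. 7.2 (the degree-`3` self-map).
-/

set_option linter.dupNamespace false

noncomputable section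

namespace Summit.HodgeConjecture.HodgeConjecture.Theorems.MarkmanPartnerTransport.IsogenyDatum

open scoped Manifold
open Module CategoryTheory MonoidalCategory CartesianMonoidalCategory
open Literature.AlgebraicGeometry Literature.AlgebraicGeometry.Motives Literature.AlgebraicGeometry.HodgeTheory
open Literature.AlgebraicGeometry.Surfaces
open Literature.AlgebraicTopology.SingularHomology
open Summit.HodgeConjecture.HodgeConjecture.Theorems.MarkmanPartnerTransport.FiniteMorphism

variable {S Y Z : SchemeOver ℂ}

/-- `MarkedK3[S, η, p, x]`: VERBATIM the `let MarkedK3 := …` binder of the route declaration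
`PicardThreeK3Squares`. Local notation only. -/
local notation3 (prettyPrint := false) "MarkedK3[" S ", " η ", " p ", " x "]" =>
  (p ≠ 0 ∧ (IsIntegralClass p ∧
    (∀ q : complexBetti S (2 * 2), IsIntegralClass q → ∃ n : ℤ, q = n • p) ∧
    (∀ c : complexBetti S (2 * 1), IsIntegralClass c ↔ ∃ v : K3Index → ℤ, η c = fun i => (v i : ℂ)) ∧
    (∀ a b : complexBetti S (2 * 1),
      cupProduct (rfl : 2 * 1 + 2 * 1 = 2 * 2) a b = k3Form (η a) (η b) • p) ∧
    IsOfHodgeType 2 S (2 * 1) 2 0 (LinearEquiv.symm η x) ∧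
    (∀ τ : complexBetti S (2 * 1), IsOfHodgeType 2 S (2 * 1) 2 0 τ →
      ∃ t : ℂ, τ = t • LinearEquiv.symm η x)) ∧
    (k3Form x x = 0 ∧ 0 < (k3Form (star x) x).re ∧
      ∃ u : K3Index → ℤ, k3Form (fun i => (u i : ℂ)) x = 0 ∧ 0 < ∑ i, ∑ j, u i * k3Gram i j * u j))

/-- `Corr[X, Y, hX, hY ; γ, y] = pr₁₊ (pr₂^* y ∪ γ)` (complex orientations): VERBATIM the action in
`QuotientSimilitude.cycleInduced_of_algebraicSimilitude` at `μ = complexOrientationFamily`. -/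
local notation3 (prettyPrint := false) "Corr[" X ", " Y ", " hX ", " hY " ; " γ ", " y "]" =>
  complexGysin complexOrientationFamily (IsSmoothProjective.tensor_holds hX hY) hX
    (SemiCartesianMonoidalCategory.fst X Y)
    (rfl : 2 * 1 + 2 * 2 + 2 * 2 = 2 * 1 + 2 * (2 + 2))
    (cupProduct (rfl : 2 * 1 + 2 * 2 = 2 * 1 + 2 * 2)
      (complexBetti.map (SemiCartesianMonoidalCategory.snd X Y) (2 * 1) y) γ)

/-- `Deg[hZ, hX, f, d]`: `f₊ 1 = d • 1` (cohomological degree `d`, complex orientations). -/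
local notation3 (prettyPrint := false) "Deg[" hZ ", " hX ", " f ", " d "]" =>
  complexGysin complexOrientationFamily hZ hX f (rfl : 0 + 2 * 2 = 0 + 2 * 2)
      (singularCohomology.one ℂ (Motives.ComplexPoints _)) =
    (d : ℂ) • singularCohomology.one ℂ (Motives.ComplexPoints _)

/-- `Graph[hZ, hX, hY, f, π] = (f, π)₊ 1 ∈ H⁴((X ⊗ Y)(ℂ); ℂ)`, the class of the roof. -/
local notation3 (prettyPrint := false) "Graph[" hZ ", " hX ", " hY ", " f ", " π "]" =>
  complexGysin complexOrientationFamily hZ (IsSmoothProjective.tensor_holds hX hY) (lift f π)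
    (rfl : 0 + 2 * (2 + 2) = 2 * 2 + 2 * 2)
    (singularCohomology.one ℂ (Motives.ComplexPoints _))

/-! ### §1 The datum clauses of `φ = f₊ π^*` that need no normalisation -/

section Clauses

variable (hZ : IsSmoothProjective 2 Z) (hX : IsSmoothProjective 2 S) (hY : IsSmoothProjective 2 Y)
  (f : Z ⟶ S) (π : Z ⟶ Y)

include hZ hX hY f π in
/-- `[Graph]_* y ∈ T(X)` for `y ∈ T(Y)` (`φ = f₊ π^*`; `π^* T(Y) ⊆ T(Z)`, `f₊ T(Z) ⊆ T(X)`).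
[cite: Inose1978, §2] [cite: Morrison1987Isogenies, §1 p. 180] -/
theorem datum_transcendental {y : complexBetti Y (2 * 1)} (hy : y ∈ transcendentalSubspace Y) :
    Corr[S, Y, hX, hY ; Graph[hZ, hX, hY, f, π], y] ∈ transcendentalSubspace S := by
  rw [corr_gysinLift_one hZ hX hY f π y]
  exact gysin_mem_transcendentalSubspace hZ hX f (map_mem_transcendentalSubspace hZ hY π hy)

include hZ hX hY f π in
/-- `[Graph]_*` maps rational classes to rational classes. [cite: VoisinHodgeI2002, §7.3.2] -/
theorem datum_rational {y : complexBetti Y (2 * 1)} (hy : IsRationalClass y) :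
    IsRationalClass (Corr[S, Y, hX, hY ; Graph[hZ, hX, hY, f, π], y]) := by
  rw [corr_gysinLift_one hZ hX hY f π y]
  exact isRationalClass_gysin_map hZ hX f π hy

include hZ hX hY f π in
/-- `[Graph]_*` preserves Hodge types. [cite: VoisinHodgeI2002, §7.3.2] -/
theorem datum_hodgeType {i j : ℕ} {y : complexBetti Y (2 * 1)} (hy : IsOfHodgeType 2 Y (2 * 1) i j y) :
    IsOfHodgeType 2 S (2 * 1) i j (Corr[S, Y, hX, hY ; Graph[hZ, hX, hY, f, π], y]) := by
  rw [corr_gysinLift_one hZ hX hY f π y]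
  exact isOfHodgeType_gysin_map hZ hX f π hY hy

end Clauses

/-! ### §2 Onto and the multiplier, from the degrees and `T(Z) = f^* T(X) = π^* T(Y)` -/

section Multiplier

variable {hZ : IsSmoothProjective 2 Z} {hX : IsSmoothProjective 2 S} {hY : IsSmoothProjective 2 Y}
  {f : Z ⟶ S} {π : Z ⟶ Y} {n d : ℕ}

/-- **`[Graph]_*` maps `T(Y)` ONTO `T(X)`**: `z = f₊ w`, `w ∈ T(Z) = π^* T(Y)` (`f` of degree
`n ≠ 0`, `π^*` injective, `p_g(Z) = p_g(Y) = 1`). [cite: Inose1978, §2] -/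
theorem datum_onto (hdegf : Deg[hZ, hX, f, n]) (hn : n ≠ 0)
    (hπinj : Function.Injective (complexBetti.map π (2 * 1)))
    (h1Z : HasGeometricGenusOne Z) (h1Y : HasGeometricGenusOne Y)
    {z : complexBetti S (2 * 1)} (hz : z ∈ transcendentalSubspace S) :
    ∃ y ∈ transcendentalSubspace Y, Corr[S, Y, hX, hY ; Graph[hZ, hX, hY, f, π], y] = z := by
  obtain ⟨w, hw, hwz⟩ := gysin_surjOn_transcendentalSubspace hdegf (Nat.cast_ne_zero.2 hn) hz
  rw [transcendentalSubspace_eq_map_of_hasGeometricGenusOne hZ hY π hπinj h1Z h1Y] at hw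
  obtain ⟨y, hy, rfl⟩ := hw
  refine ⟨y, hy, ?_⟩
  rw [corr_gysinLift_one hZ hX hY f π y]
  exact hwz

/-- **The multiplier in trace form: `∫_X ([Graph]_* a ∪ [Graph]_* b) = n d · ∫_Y (a ∪ b)`** on `T(Y)`
(`π^* a ∈ T(Z) = f^* T(X)`, `∫_X (f₊ w ∪ f₊ w') = n ∫_Z (w ∪ w')`, `∫_Z (π^* a ∪ π^* b) = d ∫_Y (a ∪ b)`).
[cite: Inose1978, §2] [cite: Morrison1987Isogenies, §1 Definition (strict isogeny)] -/
theorem traceC_cup_datum (hdegf : Deg[hZ, hX, f, n]) (hn : n ≠ 0) (hdegπ : Deg[hZ, hY, π, d])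
    (h1Z : HasGeometricGenusOne Z) (h1X : HasGeometricGenusOne S)
    {a b : complexBetti Y (2 * 1)} (ha : a ∈ transcendentalSubspace Y) :
    traceC hX (cupProduct (rfl : 2 * 1 + 2 * 1 = 2 * 2)
        (Corr[S, Y, hX, hY ; Graph[hZ, hX, hY, f, π], a]) (Corr[S, Y, hX, hY ; Graph[hZ, hX, hY, f, π], b])) =
      (n : ℂ) * (d : ℂ) * traceC hY (cupProduct (rfl : 2 * 1 + 2 * 1 = 2 * 2) a b) := by
  have hfinj := map_injective_of_deg hdegf (Nat.cast_ne_zero.2 hn) (2 * 1)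
  have hle : transcendentalSubspace Z ≤ (transcendentalSubspace S).map (complexBetti.map f (2 * 1)).hom :=
    le_of_eq (transcendentalSubspace_eq_map_of_hasGeometricGenusOne hZ hX f hfinj h1Z h1X)
  rw [corr_gysinLift_one hZ hX hY f π a, corr_gysinLift_one hZ hX hY f π b,
    traceC_cup_gysin_gysin_of_le hdegf hle (map_mem_transcendentalSubspace hZ hY π ha),
    traceC_cup_map_map hdegπ, mul_assoc]

/-- **The multiplier in the markings, granted equal traces of the generators**: for marked `(X, η, p)`,
`(Y, η_Y, p_Y)` with `∫_X p = ∫_Y p_Y`, `(η[Graph]_*a · η[Graph]_*b) = n d (η_Y a · η_Y b)` on `T(Y)`.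
[cite: Varesco2023, §2 (multiplier of a similitude)] [cite: Inose1978, §2] -/
theorem k3Form_datum_of_traceC_eq (hdegf : Deg[hZ, hX, f, n]) (hn : n ≠ 0) (hdegπ : Deg[hZ, hY, π, d])
    (h1Z : HasGeometricGenusOne Z) (h1X : HasGeometricGenusOne S)
    (η : complexBetti S (2 * 1) ≃ₗ[ℂ] (K3Index → ℂ)) (p : complexBetti S (2 * 2)) (hp0 : p ≠ 0)
    (hηcup : ∀ a b : complexBetti S (2 * 1),
      cupProduct (rfl : 2 * 1 + 2 * 1 = 2 * 2) a b = k3Form (η a) (η b) • p)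
    (ηY : complexBetti Y (2 * 1) ≃ₗ[ℂ] (K3Index → ℂ)) (pY : complexBetti Y (2 * 2))
    (hηYcup : ∀ a b : complexBetti Y (2 * 1),
      cupProduct (rfl : 2 * 1 + 2 * 1 = 2 * 2) a b = k3Form (ηY a) (ηY b) • pY)
    (htr : traceC hX p = traceC hY pY)
    {a b : complexBetti Y (2 * 1)} (ha : a ∈ transcendentalSubspace Y) :
    k3Form (η (Corr[S, Y, hX, hY ; Graph[hZ, hX, hY, f, π], a]))
        (η (Corr[S, Y, hX, hY ; Graph[hZ, hX, hY, f, π], b])) =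
      ((n * d : ℕ) : ℂ) * k3Form (ηY a) (ηY b) := by
  have h := traceC_cup_datum (hY := hY) (π := π) hdegf hn hdegπ h1Z h1X (b := b) ha
  rw [hηcup, hηYcup, map_smul, map_smul, smul_eq_mul, smul_eq_mul, htr] at h
  have hτ : traceC hY pY ≠ 0 := by
    rw [← htr]
    exact fun h0 ↦ hp0 (eq_zero_of_traceC_eq_zero hX h0)
  rw [Nat.cast_mul]
  refine mul_right_cancel₀ (b := traceC hY pY) hτ ?_
  rw [h]
  ring

end Multiplier


/-! ### §3 The similitude `√(n d)` is cycle-induced; HC⁴ under the sector clause -/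

/-- **A roof of degrees `(n, d)` between marked projective K3 surfaces makes every Hodge similitude
`ψ` of `T(X)` with `ψ² = n d` CYCLE-INDUCED** (modulo Buskin and the trace normalisation `htr`): the
graph class `(f, π)₊ 1` is a Varesco datum of multiplier `n d`
(`QuotientSimilitude.cycleInduced_of_algebraicSimilitude`). Hypotheses on `ψ`: maps `T(X)` to itself,
rational and type-preserving there, `ψ² = n d` and multiplier `n d` on `T(X)`.
[cite: Varesco2023, §2 Thm. 2.1 (proof, p. 8)] [cite: Inose1978, §2] [cite: Buskin2019, Thm. 1.1] -/
theorem cycleInduced_of_roof (hB : Buskin2019_hodgeIsometry_algebraic)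
    (hS : IsK3Surface S)
    (η : complexBetti S (2 * 1) ≃ₗ[ℂ] (K3Index → ℂ)) (p : complexBetti S (2 * 2)) (x : K3Index → ℂ)
    (hM : MarkedK3[S, η, p, x])
    (hY : IsK3Surface Y)
    (ηY : complexBetti Y (2 * 1) ≃ₗ[ℂ] (K3Index → ℂ)) (pY : complexBetti Y (2 * 2)) (xY : K3Index → ℂ)
    (hMY : MarkedK3[Y, ηY, pY, xY])
    (hZ : IsSmoothProjective 2 Z) (h1Z : HasGeometricGenusOne Z)
    (f : Z ⟶ S) (π : Z ⟶ Y) {n d : ℕ} (hn : n ≠ 0) (hd : d ≠ 0)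
    (hdegf : Deg[hZ, hS.1, f, n]) (hdegπ : Deg[hZ, hY.1, π, d])
    (htr : traceC hS.1 p = traceC hY.1 pY)
    (ψ : complexBetti S (2 * 1) →ₗ[ℂ] complexBetti S (2 * 1))
    (hψT : Set.MapsTo ψ (transcendentalSubspace S) (transcendentalSubspace S))
    (hψrat : ∀ y ∈ transcendentalSubspace S, IsRationalClass y → IsRationalClass (ψ y))
    (hψtyp : ∀ (i j : ℕ), ∀ y ∈ transcendentalSubspace S,
      IsOfHodgeType 2 S (2 * 1) i j y → IsOfHodgeType 2 S (2 * 1) i j (ψ y))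
    (hψsq : ∀ y ∈ transcendentalSubspace S, ψ (ψ y) = ((n * d : ℕ) : ℂ) • y)
    (hψmul : ∀ y ∈ transcendentalSubspace S, ∀ z ∈ transcendentalSubspace S,
      cupProduct (rfl : 2 * 1 + 2 * 1 = 2 * 2) (ψ y) (ψ z) =
        ((n * d : ℕ) : ℂ) • cupProduct (rfl : 2 * 1 + 2 * 1 = 2 * 2) y z) :
    ∃ γ' ∈ algebraicClasses (S ⊗ S) 2, ∀ z ∈ transcendentalSubspace S,
      Corr[S, S, hS.1, hS.1 ; γ', z] = ψ z := by
  have hM' := hM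
  obtain ⟨hp₀, ⟨-, -, -, hηcup, -, -⟩, -⟩ := hM'
  have hMY' := hMY
  obtain ⟨-, ⟨-, -, -, hηYcup, -, -⟩, -⟩ := hMY'
  have hπinj := map_injective_of_deg hdegπ (Nat.cast_ne_zero.2 hd) (2 * 1)
  exact QuotientSimilitude.cycleInduced_of_algebraicSimilitude hB hS η p x hM hY ηY pY xY hMY
    (Graph[hZ, hS.1, hY.1, f, π]) (gysinLift_one_mem_algebraicClasses hZ hS.1 hY.1 f π)
    (fun y hy ↦ datum_rational hZ hS.1 hY.1 f π hy)
    (fun i j y hy ↦ datum_hodgeType hZ hS.1 hY.1 f π hy)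
    (fun y hy ↦ datum_transcendental hZ hS.1 hY.1 f π hy)
    (fun z hz ↦ datum_onto (hY := hY.1) hdegf hn hπinj h1Z hY.hasGeometricGenusOne hz)
    (Nat.mul_ne_zero hn hd)
    (fun a ha b _ ↦ k3Form_datum_of_traceC_eq hdegf hn hdegπ h1Z hS.hasGeometricGenusOne η p hp₀ hηcup
      ηY pY hηYcup htr ha)
    ψ hψT hψrat hψtyp hψsq hψmul

/-- **HC⁴(X ⊗ X) for a marked projective K3 surface `X` receiving a roof of degrees `(n, d)` from a
marked projective K3 surface `Y`, whose transcendental Hodge endomorphisms are spanned by `1` and a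
Hodge similitude `ψ` with `ψ² = n d`** (modulo `Buskin2019_hodgeIsometry_algebraic` and the trace
normalisation `htr : ∫_X p = ∫_Y p_Y`). The sector clause `hU` is VERBATIM that of
`SymplecticLocus.hodgeConjectureFor_square_of_symplecticAutomorphism`. Proof: `cycleInduced_of_roof`
and `SqrtSix.hodgeConjectureFor_square_of_corr_similitude`.
[cite: Varesco2023, §2 Thm. 2.1 and Rem. 2.2] [cite: Fulton1998, §16.1 Prop. 16.1.1] -/
theorem hodgeConjectureFor_square_of_roof (hB : Buskin2019_hodgeIsometry_algebraic)
    (hS : IsK3Surface S)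
    (η : complexBetti S (2 * 1) ≃ₗ[ℂ] (K3Index → ℂ)) (p : complexBetti S (2 * 2)) (x : K3Index → ℂ)
    (hM : MarkedK3[S, η, p, x])
    (hY : IsK3Surface Y)
    (ηY : complexBetti Y (2 * 1) ≃ₗ[ℂ] (K3Index → ℂ)) (pY : complexBetti Y (2 * 2)) (xY : K3Index → ℂ)
    (hMY : MarkedK3[Y, ηY, pY, xY])
    (hZ : IsSmoothProjective 2 Z) (h1Z : HasGeometricGenusOne Z)
    (f : Z ⟶ S) (π : Z ⟶ Y) {n d : ℕ} (hn : n ≠ 0) (hd : d ≠ 0)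
    (hdegf : Deg[hZ, hS.1, f, n]) (hdegπ : Deg[hZ, hY.1, π, d])
    (htr : traceC hS.1 p = traceC hY.1 pY)
    (ψ : complexBetti S (2 * 1) →ₗ[ℂ] complexBetti S (2 * 1))
    (hψT : Set.MapsTo ψ (transcendentalSubspace S) (transcendentalSubspace S))
    (hψrat : ∀ y ∈ transcendentalSubspace S, IsRationalClass y → IsRationalClass (ψ y))
    (hψtyp : ∀ (i j : ℕ), ∀ y ∈ transcendentalSubspace S,
      IsOfHodgeType 2 S (2 * 1) i j y → IsOfHodgeType 2 S (2 * 1) i j (ψ y))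
    (hψsq : ∀ y ∈ transcendentalSubspace S, ψ (ψ y) = ((n * d : ℕ) : ℂ) • y)
    (hψmul : ∀ y ∈ transcendentalSubspace S, ∀ z ∈ transcendentalSubspace S,
      cupProduct (rfl : 2 * 1 + 2 * 1 = 2 * 2) (ψ y) (ψ z) =
        ((n * d : ℕ) : ℂ) • cupProduct (rfl : 2 * 1 + 2 * 1 = 2 * 2) y z)
    (hU : ∀ (g : complexBetti S (2 * 1) →ₗ[ℂ] complexBetti S (2 * 1)),
      (∀ y, IsRationalClass y → IsRationalClass (g y)) →
      (∀ (i j : ℕ) y, IsOfHodgeType 2 S (2 * 1) i j y → IsOfHodgeType 2 S (2 * 1) i j (g y)) →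
      (∀ e ∈ algebraicClasses S 1, g e = 0) →
      (∀ y : complexBetti S (2 * 1), ∀ e ∈ algebraicClasses S 1,
        cupProduct (rfl : 2 * 1 + 2 * 1 = 2 * 2) (g y) e = 0) →
      ∃ a b : ℚ, ∀ y : complexBetti S (2 * 1),
        (∀ e ∈ algebraicClasses S 1, cupProduct (rfl : 2 * 1 + 2 * 1 = 2 * 2) y e = 0) →
        g y = (a : ℂ) • y + (b : ℂ) • ψ y) :
    HodgeConjectureFor 4 (S ⊗ S) := by
  obtain ⟨γ', hγ'alg, hγ'⟩ := cycleInduced_of_roof hB hS η p x hM hY ηY pY xY hMY hZ h1Z f π hn hd hdegf hdegπ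
    htr ψ hψT hψrat hψtyp hψsq hψmul
  -- the action of `γ'` as a linear map
  set T₀ : complexBetti S (2 * 1) →ₗ[ℂ] complexBetti S (2 * 1) :=
    (complexGysin complexOrientationFamily (IsSmoothProjective.tensor_holds hS.1 hS.1) hS.1
        (SemiCartesianMonoidalCategory.fst S S) (rfl : 2 * 1 + 2 * 2 + 2 * 2 = 2 * 1 + 2 * (2 + 2))) ∘ₗ
      ((cupProduct (rfl : 2 * 1 + 2 * 2 = 2 * 1 + 2 * 2)).flip γ') ∘ₗ
      (complexBetti.map (SemiCartesianMonoidalCategory.snd S S) (2 * 1)).hom with hT₀def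
  have hT₀ : ∀ y, T₀ y = Corr[S, S, hS.1, hS.1 ; γ', y] := fun y ↦ rfl
  exact SqrtSix.hodgeConjectureFor_square_of_corr_similitude hS ψ T₀ γ' hγ'alg hT₀
    (fun z hz ↦ by rw [hT₀]; exact hγ' z hz) hU


/-! ### §4 The trace normalisation holds: unconditional forms -/

/-- **`∫_X p = ∫_Y p_Y` for two marked projective K3 surfaces joined by a roof** of morphisms of
non-zero cohomological degrees from a smooth projective surface of geometric genus one: both traces are
`± ε₀⁻¹` (`IntegralGeneratorTrace`), and the sign is fixed by the `(2,0)`-classes (brick 4).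
[cite: HatcherAT2002, §3.3 Thm. 3.30] [cite: Huybrechts2016K3, Ch. 6 §1.1] -/
theorem traceC_eq_traceC_of_markedRoof (hS : IsK3Surface S)
    (η : complexBetti S (2 * 1) ≃ₗ[ℂ] (K3Index → ℂ)) (p : complexBetti S (2 * 2)) (x : K3Index → ℂ)
    (hM : MarkedK3[S, η, p, x])
    (hY : IsK3Surface Y)
    (ηY : complexBetti Y (2 * 1) ≃ₗ[ℂ] (K3Index → ℂ)) (pY : complexBetti Y (2 * 2)) (xY : K3Index → ℂ)
    (hMY : MarkedK3[Y, ηY, pY, xY])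
    (hZ : IsSmoothProjective 2 Z) (h1Z : HasGeometricGenusOne Z)
    (f : Z ⟶ S) (π : Z ⟶ Y) {n d : ℕ} (hn : n ≠ 0) (hd : d ≠ 0)
    (hdegf : Deg[hZ, hS.1, f, n]) (hdegπ : Deg[hZ, hY.1, π, d]) :
    traceC hS.1 p = traceC hY.1 pY := by
  have hM' := hM
  obtain ⟨-, ⟨hpint, hpgen, hηint, hηcup, hx20, -⟩, -, hxpos, -⟩ := hM'
  have hMY' := hMY
  obtain ⟨hpY0, ⟨hpYint, hpYgen, hηYint, hηYcup, hxY20, -⟩, -, hxYpos, -⟩ := hMY'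
  have hτY : traceC hY.1 pY ≠ 0 := fun h ↦ hpY0 (eq_zero_of_traceC_eq_zero hY.1 h)
  exact traceC_eq_traceC_of_roof hdegf hn hdegπ hd h1Z η p x hηint hηcup hx20 hxpos ηY pY xY hηYint hηYcup
    hxY20 hxYpos hτY (traceC_eq_or_eq_neg_traceC_of_integral_generators hS.1 hY.1 hpint hpgen hpYint hpYgen)

/-- **UNCONDITIONAL FORM of `cycleInduced_of_roof`** (modulo `Buskin2019_hodgeIsometry_algebraic` only):
a roof of degrees `(n, d)` between marked projective K3 surfaces makes every Hodge similitude `ψ` of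
`T(X)` with `ψ² = n d` cycle-induced. [cite: Varesco2023, §2 Thm. 2.1] [cite: Inose1978, §2]
[cite: Buskin2019, Thm. 1.1] -/
theorem cycleInduced_of_roof' (hB : Buskin2019_hodgeIsometry_algebraic)
    (hS : IsK3Surface S)
    (η : complexBetti S (2 * 1) ≃ₗ[ℂ] (K3Index → ℂ)) (p : complexBetti S (2 * 2)) (x : K3Index → ℂ)
    (hM : MarkedK3[S, η, p, x])
    (hY : IsK3Surface Y)
    (ηY : complexBetti Y (2 * 1) ≃ₗ[ℂ] (K3Index → ℂ)) (pY : complexBetti Y (2 * 2)) (xY : K3Index → ℂ)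
    (hMY : MarkedK3[Y, ηY, pY, xY])
    (hZ : IsSmoothProjective 2 Z) (h1Z : HasGeometricGenusOne Z)
    (f : Z ⟶ S) (π : Z ⟶ Y) {n d : ℕ} (hn : n ≠ 0) (hd : d ≠ 0)
    (hdegf : Deg[hZ, hS.1, f, n]) (hdegπ : Deg[hZ, hY.1, π, d])
    (ψ : complexBetti S (2 * 1) →ₗ[ℂ] complexBetti S (2 * 1))
    (hψT : Set.MapsTo ψ (transcendentalSubspace S) (transcendentalSubspace S))
    (hψrat : ∀ y ∈ transcendentalSubspace S, IsRationalClass y → IsRationalClass (ψ y))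
    (hψtyp : ∀ (i j : ℕ), ∀ y ∈ transcendentalSubspace S,
      IsOfHodgeType 2 S (2 * 1) i j y → IsOfHodgeType 2 S (2 * 1) i j (ψ y))
    (hψsq : ∀ y ∈ transcendentalSubspace S, ψ (ψ y) = ((n * d : ℕ) : ℂ) • y)
    (hψmul : ∀ y ∈ transcendentalSubspace S, ∀ z ∈ transcendentalSubspace S,
      cupProduct (rfl : 2 * 1 + 2 * 1 = 2 * 2) (ψ y) (ψ z) =
        ((n * d : ℕ) : ℂ) • cupProduct (rfl : 2 * 1 + 2 * 1 = 2 * 2) y z) :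
    ∃ γ' ∈ algebraicClasses (S ⊗ S) 2, ∀ z ∈ transcendentalSubspace S,
      Corr[S, S, hS.1, hS.1 ; γ', z] = ψ z :=
  cycleInduced_of_roof hB hS η p x hM hY ηY pY xY hMY hZ h1Z f π hn hd hdegf hdegπ
    (traceC_eq_traceC_of_markedRoof hS η p x hM hY ηY pY xY hMY hZ h1Z f π hn hd hdegf hdegπ)
    ψ hψT hψrat hψtyp hψsq hψmul

/-- **UNCONDITIONAL FORM of `hodgeConjectureFor_square_of_roof`** (modulo Buskin only): HC⁴(X ⊗ X) for a
marked projective K3 surface receiving a roof of degrees `(n, d)` from a marked projective K3 surface,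
whose transcendental Hodge endomorphisms are spanned by `1` and a Hodge similitude `ψ`, `ψ² = n d`.
[cite: Varesco2023, §2 Thm. 2.1 and Rem. 2.2] [cite: Fulton1998, §16.1 Prop. 16.1.1] -/
theorem hodgeConjectureFor_square_of_roof' (hB : Buskin2019_hodgeIsometry_algebraic)
    (hS : IsK3Surface S)
    (η : complexBetti S (2 * 1) ≃ₗ[ℂ] (K3Index → ℂ)) (p : complexBetti S (2 * 2)) (x : K3Index → ℂ)
    (hM : MarkedK3[S, η, p, x])
    (hY : IsK3Surface Y)
    (ηY : complexBetti Y (2 * 1) ≃ₗ[ℂ] (K3Index → ℂ)) (pY : complexBetti Y (2 * 2)) (xY : K3Index → ℂ)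
    (hMY : MarkedK3[Y, ηY, pY, xY])
    (hZ : IsSmoothProjective 2 Z) (h1Z : HasGeometricGenusOne Z)
    (f : Z ⟶ S) (π : Z ⟶ Y) {n d : ℕ} (hn : n ≠ 0) (hd : d ≠ 0)
    (hdegf : Deg[hZ, hS.1, f, n]) (hdegπ : Deg[hZ, hY.1, π, d])
    (ψ : complexBetti S (2 * 1) →ₗ[ℂ] complexBetti S (2 * 1))
    (hψT : Set.MapsTo ψ (transcendentalSubspace S) (transcendentalSubspace S))
    (hψrat : ∀ y ∈ transcendentalSubspace S, IsRationalClass y → IsRationalClass (ψ y))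
    (hψtyp : ∀ (i j : ℕ), ∀ y ∈ transcendentalSubspace S,
      IsOfHodgeType 2 S (2 * 1) i j y → IsOfHodgeType 2 S (2 * 1) i j (ψ y))
    (hψsq : ∀ y ∈ transcendentalSubspace S, ψ (ψ y) = ((n * d : ℕ) : ℂ) • y)
    (hψmul : ∀ y ∈ transcendentalSubspace S, ∀ z ∈ transcendentalSubspace S,
      cupProduct (rfl : 2 * 1 + 2 * 1 = 2 * 2) (ψ y) (ψ z) =
        ((n * d : ℕ) : ℂ) • cupProduct (rfl : 2 * 1 + 2 * 1 = 2 * 2) y z)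
    (hU : ∀ (g : complexBetti S (2 * 1) →ₗ[ℂ] complexBetti S (2 * 1)),
      (∀ y, IsRationalClass y → IsRationalClass (g y)) →
      (∀ (i j : ℕ) y, IsOfHodgeType 2 S (2 * 1) i j y → IsOfHodgeType 2 S (2 * 1) i j (g y)) →
      (∀ e ∈ algebraicClasses S 1, g e = 0) →
      (∀ y : complexBetti S (2 * 1), ∀ e ∈ algebraicClasses S 1,
        cupProduct (rfl : 2 * 1 + 2 * 1 = 2 * 2) (g y) e = 0) →
      ∃ a b : ℚ, ∀ y : complexBetti S (2 * 1),
        (∀ e ∈ algebraicClasses S 1, cupProduct (rfl : 2 * 1 + 2 * 1 = 2 * 2) y e = 0) →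
        g y = (a : ℂ) • y + (b : ℂ) • ψ y) :
    HodgeConjectureFor 4 (S ⊗ S) :=
  hodgeConjectureFor_square_of_roof hB hS η p x hM hY ηY pY xY hMY hZ h1Z f π hn hd hdegf hdegπ
    (traceC_eq_traceC_of_markedRoof hS η p x hM hY ηY pY xY hMY hZ h1Z f π hn hd hdegf hdegπ)
    ψ hψT hψrat hψtyp hψsq hψmul hU

end Summit.HodgeConjecture.HodgeConjecture.Theorems.MarkmanPartnerTransport.IsogenyDatum

end
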